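import Summits.AtomisticToContinuum.Crystallization.Theorems.FrustratedLawDichotomyStrainedPatchHomLeafTableSoundB

/-!
# v2 leaf checker — Boolean certificates for the LABEL LIST invariants (so a literal data file only needs `decide`)

decomp-a2c hand-1 g20 (crux `AperiodicFrustratedLawGap`, stmt-AtomisticToContinuum-27623; critic row 806 (2)(C)).  The hypotheses of `leafCheck_sound`
about the near-label list — records consistent (`NL.ok`), labels in `[−7,7]³∖0`, canonical signs (no label is the negative of another), pairwise
distinct labels, sorted by `n`, class sums — are discharged here from kernel-evaluable Boolean checks over the list: `allNLok`, `allInBox`,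
`allCanon`, `chainLt` (adjacent strict lexicographic order on `(n, b0, b1, b2)`), `sumM`.  0 sorry; standard axioms.  `--supports stmt-AtomisticToContinuum-27623`.
-/

namespace Summit.AtomisticToContinuum.Crystallization.Theorems.FrustratedLawDichotomyStrainedPatchHomLeafTableCheck

/-! ## §1. The checks -/

/-- All records consistent. -/
def allNLok : List NL → Bool
  | [] => true
  | l :: ls => l.ok && allNLok ls

/-- Label in `[−7,7]³ ∖ 0`. -/
def NL.inBox (l : NL) : Bool :=
  decide (-7 ≤ l.b0 ∧ l.b0 ≤ 7 ∧ -7 ≤ l.b1 ∧ l.b1 ≤ 7 ∧ -7 ≤ l.b2 ∧ l.b2 ≤ 7 ∧ ¬ (l.b0 = 0 ∧ l.b1 = 0 ∧ l.b2 = 0))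

/-- All labels in the box. -/
def allInBox : List NL → Bool
  | [] => true
  | l :: ls => l.inBox && allInBox ls

/-- Canonical sign: the first non-zero coordinate is positive. -/
def NL.canon (l : NL) : Bool :=
  decide (0 < l.b0 ∨ (l.b0 = 0 ∧ (0 < l.b1 ∨ (l.b1 = 0 ∧ 0 < l.b2))))

/-- All labels canonical. -/
def allCanon : List NL → Bool
  | [] => true
  | l :: ls => l.canon && allCanon ls

/-- Strict lexicographic order on `(n, b0, b1, b2)`. -/
def NL.ltKey (l l' : NL) : Bool :=
  decide (l.n < l'.n ∨ (l.n = l'.n ∧ (l.b0 < l'.b0 ∨ (l.b0 = l'.b0 ∧ (l.b1 < l'.b1 ∨ (l.b1 = l'.b1 ∧ l.b2 < l'.b2))))))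

/-- Adjacent records strictly increasing in the key. -/
def chainLt : List NL → Bool
  | [] => true
  | [_] => true
  | l :: l' :: ls => l.ltKey l' && chainLt (l' :: ls)

/-- Class sums `(Σ m00, Σ m11, Σ m22, Σ m01, Σ m02, Σ m12)`. -/
def sumM : List NL → ℕ × ℕ × ℕ × ℕ × ℕ × ℕ
  | [] => (0, 0, 0, 0, 0, 0)
  | l :: ls =>
    match sumM ls with
    | (a0, a1, a2, a3, a4, a5) => (l.m00 + a0, l.m11 + a1, l.m22 + a2, l.m01 + a3, l.m02 + a4, l.m12 + a5)

/-! ## §2. Their meaning -/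

/-- `allNLok` ⟹ every record is consistent. [formal bookkeeping] -/
theorem ok_of_allNLok : ∀ {ls : List NL}, allNLok ls = true → ∀ l ∈ ls, l.ok = true
  | [], _, l, hl => (List.not_mem_nil hl).elim
  | l' :: ls, h, l, hl => by
    simp only [allNLok, Bool.and_eq_true] at h
    rcases List.mem_cons.1 hl with rfl | hl'
    · exact h.1
    · exact ok_of_allNLok h.2 l hl'

/-- `allInBox` ⟹ every label lies in `[−7,7]³ ∖ 0`. [formal bookkeeping] -/
theorem box_of_allInBox : ∀ {ls : List NL}, allInBox ls = true →
    ∀ l ∈ ls, l.toLab ∈ (Fintype.piFinset fun _ : Fin 3 => Finset.Icc (-7 : ℤ) 7).filter (fun b => b ≠ 0)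
  | [], _, l, hl => (List.not_mem_nil hl).elim
  | l' :: ls, h, l, hl => by
    simp only [allInBox, Bool.and_eq_true] at h
    rcases List.mem_cons.1 hl with rfl | hl'
    · have hb := h.1
      unfold NL.inBox at hb
      simp only [decide_eq_true_eq] at hb
      obtain ⟨h0, h0', h1, h1', h2, h2', hne⟩ := hb
      rw [mem_box7_iff]
      refine ⟨fun i => ?_, fun hz => hne ?_⟩
      · fin_cases i <;> simp [NL.toLab] <;> omega
      · have e0 := congrFun hz 0
        have e1 := congrFun hz 1
        have e2 := congrFun hz 2
        simp [NL.toLab] at e0 e1 e2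
        exact ⟨e0, e1, e2⟩
    · exact box_of_allInBox h.2 l hl'

/-- Two canonical labels are never negatives of each other. [formal bookkeeping] -/
theorem ne_neg_of_canon {l l' : NL} (h : l.canon = true) (h' : l'.canon = true) : l.toLab ≠ -l'.toLab := by
  unfold NL.canon at h h'
  simp only [decide_eq_true_eq] at h h'
  intro he
  have e0 := congrFun he 0
  have e1 := congrFun he 1
  have e2 := congrFun he 2
  simp [NL.toLab] at e0 e1 e2
  omega

/-- `allCanon` ⟹ no label of the list is the negative of another. [formal bookkeeping] -/
theorem canon_of_allCanon : ∀ {ls : List NL}, allCanon ls = true → ∀ l ∈ ls, l.canon = true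
  | [], _, l, hl => (List.not_mem_nil hl).elim
  | l' :: ls, h, l, hl => by
    simp only [allCanon, Bool.and_eq_true] at h
    rcases List.mem_cons.1 hl with rfl | hl'
    · exact h.1
    · exact canon_of_allCanon h.2 l hl'

/-- The key order is transitive. [formal bookkeeping] -/
theorem NL.ltKey_trans {a b c : NL} (h1 : a.ltKey b = true) (h2 : b.ltKey c = true) : a.ltKey c = true := by
  unfold NL.ltKey at *
  simp only [decide_eq_true_eq] at *
  omega

/-- A key-smaller record has a different label or a different norm; with consistent records (norm determined by the label) the labels differ.
[formal bookkeeping] -/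
theorem toLab_ne_of_ltKey {a b : NL} (ha : a.ok = true) (hb : b.ok = true) (h : a.ltKey b = true) : a.toLab ≠ b.toLab := by
  intro he
  have e0 := congrFun he 0
  have e1 := congrFun he 1
  have e2 := congrFun he 2
  simp [NL.toLab] at e0 e1 e2
  obtain ⟨hna, -⟩ := (NL.ok_iff a).1 ha
  obtain ⟨hnb, -⟩ := (NL.ok_iff b).1 hb
  have hn : (a.n : ℤ) = b.n := by rw [hna, hnb, e0, e1, e2]
  unfold NL.ltKey at h
  simp only [decide_eq_true_eq] at h
  omega

/-- `chainLt` ⟹ pairwise key order. [formal bookkeeping] -/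
theorem pairwise_of_chainLt : ∀ {ls : List NL}, chainLt ls = true → ls.Pairwise (fun a b => a.ltKey b = true)
  | [], _ => List.Pairwise.nil
  | [l], _ => List.pairwise_singleton _ l
  | l :: l' :: ls, h => by
    simp only [chainLt, Bool.and_eq_true] at h
    have ih := pairwise_of_chainLt h.2
    refine List.Pairwise.cons ?_ ih
    intro x hx
    rcases List.mem_cons.1 hx with rfl | hx'
    · exact h.1
    · exact NL.ltKey_trans h.1 (List.rel_of_pairwise_cons ih hx')

/-- `chainLt` (+ consistency) ⟹ the labels are pairwise distinct and the list is sorted by `n`. [formal bookkeeping] -/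
theorem nodup_sorted_of_chainLt {ls : List NL} (hok : allNLok ls = true) (h : chainLt ls = true) :
    (ls.map NL.toLab).Nodup ∧ ls.Pairwise (fun x y => x.n ≤ y.n) := by
  have hp := pairwise_of_chainLt h
  refine ⟨?_, hp.imp_of_mem (fun {a b} _ _ hab => ?_)⟩
  · unfold List.Nodup
    exact List.pairwise_map.2 (hp.imp_of_mem fun {a b} ha hb hab => toLab_ne_of_ltKey (ok_of_allNLok hok a ha) (ok_of_allNLok hok b hb) hab)
  · unfold NL.ltKey at hab
    simp only [decide_eq_true_eq] at hab
    omega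

/-- `allCanon` ⟹ the canonical-sign hypothesis of `leafCheck_sound`. [formal bookkeeping] -/
theorem canon_hyp_of_allCanon {ls : List NL} (h : allCanon ls = true) : ∀ l ∈ ls, ∀ l' ∈ ls, l.toLab ≠ -l'.toLab :=
  fun l hl l' hl' => ne_neg_of_canon (canon_of_allCanon h l hl) (canon_of_allCanon h l' hl')

/-- `sumM` computes the six class sums. [formal bookkeeping] -/
theorem sumM_eq : ∀ (ls : List NL), sumM ls = ((ls.map NL.m00).sum, (ls.map NL.m11).sum, (ls.map NL.m22).sum, (ls.map NL.m01).sum,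
    (ls.map NL.m02).sum, (ls.map NL.m12).sum)
  | [] => rfl
  | l :: ls => by
    simp only [sumM, sumM_eq ls, List.map_cons, List.sum_cons]

/-- From the evaluated class sums to the bounds used by `leafCheck_sound`. [formal bookkeeping] -/
theorem classSums_of_sumM {ls : List NL} {A0 A1 A2 A3 A4 A5 : ℕ} (h : sumM ls = (A0, A1, A2, A3, A4, A5)) :
    (ls.map NL.m00).sum ≤ A0 ∧ (ls.map NL.m11).sum ≤ A1 ∧ (ls.map NL.m22).sum ≤ A2 ∧ (ls.map NL.m01).sum ≤ A3 ∧
      (ls.map NL.m02).sum ≤ A4 ∧ (ls.map NL.m12).sum ≤ A5 := by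
  rw [sumM_eq] at h
  simp only [Prod.mk.injEq] at h
  obtain ⟨h0, h1, h2, h3, h4, h5⟩ := h
  exact ⟨h0.le, h1.le, h2.le, h3.le, h4.le, h5.le⟩

end Summit.AtomisticToContinuum.Crystallization.Theorems.FrustratedLawDichotomyStrainedPatchHomLeafTableCheck
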